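import Literature.Analysis.PDE.ParabolicMaximumPrinciple1D
import Mathlib.Analysis.SpecialFunctions.ExpDeriv
import HarnessLib

/-!
# A weak maximum principle for Hamilton's Harnack pair on `[-1, 1]` (degenerate endpoints)

Analysis/PDE support file (everything proved; no definitions, no named facts).  In the variable
`s = cos θ ∈ [-1, 1]` the radial heat operator of the round `S⁴` is
`L = (1 - s²) ∂²_s - 4 s ∂_s`; its diffusion coefficient vanishes at the endpoints `s = ±1`
(the poles), where NO boundary condition is imposed: at an endpoint minimum the drift `∓4 ∂_s`
already has the right sign.  For R. S. Hamilton's matrix Harnack quantities of a positive radial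
solution (*A matrix Harnack estimate for the heat equation*, Comm. Anal. Geom. 1 (1993), §4–5) —
the radial and tangential Hessian eigenvalues `N₁`, `N₂` of `log u` shifted by `1/(2t)` — one gets
a weakly coupled pair

  `∂_τ N₁ ≥ L N₁ + p (1-s²) ∂_s N₁ + c₁ N₁ - 6 g`,  `∂_τ N₂ ≥ L N₂ + p (1-s²) ∂_s N₂ + c₂ N₂ + 2 g`,
  `N₁ - N₂ = (1 - s²) g`,  `∂_s (N₁ - N₂) = ∓ 2 g` at `s = ±1`,

and we prove the **weak maximum principle for this pair**: if `N₁, N₂ ≥ 0` at the initial time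
then `N₁, N₂ ≥ 0` later (`hamiltonPair_nonneg`, bounded `c₁, c₂`; `hamiltonPair_nonneg_of_nonpos`
for `c₁, c₂ ≤ 0`, to which the general case reduces by the weight `e^{-Mτ}`).  Proof: minimise
`min(N₁, N₂) + ε(1 + τ - τ₀)` over the compact rectangle (as in
`ParabolicMaximumPrinciple1D.lean`); at a negative minimum, in the interior `∂_s N_i = 0`,
`∂²_s N_i ≥ 0` and the coupling has the right sign, at an endpoint both quantities agree and
`-4 ∂_s N₁ - 6 g = -∂_s N₁ - 3 ∂_s N₂ ≥ 0`; the left time derivative is `≤ -ε`, contradiction.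

* `hasDerivAt_nonpos_of_ge_left`, `hasDerivAt_nonneg_of_ge_right` — one-sided first-order
  conditions at a minimum (the second-order condition is `deriv_deriv_nonpos_of_isLocalMax` of
  `ParabolicMaximumPrinciple1D.lean` applied to `-N`).

## References
* R. S. Hamilton, Comm. Anal. Geom. 1 (1993) 113–126, §4–5. [Hamilton1993Harnack]
* G. M. Lieberman, *Second order parabolic differential equations* (1996), Ch. II. [Lieberman1996]
-/

noncomputable section

open Set Filter Topology

namespace Literature.Analysis.PDE

/-! ### One-sided first-order conditions at a minimum -/

/-- If `g` has derivative `g'` at `x` and `g x ≤ g y` for `y < x` near `x`, then `g' ≤ 0`.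
[folklore] -/
theorem hasDerivAt_nonpos_of_ge_left {g : ℝ → ℝ} {x g' : ℝ} (hg : HasDerivAt g g' x)
    (hle : ∀ᶠ y in 𝓝[<] x, g x ≤ g y) : g' ≤ 0 := by
  have ht : Tendsto (slope g x) (𝓝[<] x) (𝓝 g') :=
    hg.tendsto_slope.mono_left (nhdsWithin_mono x fun y hy => ne_of_lt hy)
  refine le_of_tendsto ht ?_
  filter_upwards [hle, self_mem_nhdsWithin] with y h1 h2
  rw [slope_def_field]
  exact div_nonpos_of_nonneg_of_nonpos (by linarith) (by linarith [mem_Iio.1 h2])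

/-- If `g` has derivative `g'` at `x` and `g x ≤ g y` for `y > x` near `x`, then `0 ≤ g'`.
[folklore] -/
theorem hasDerivAt_nonneg_of_ge_right {g : ℝ → ℝ} {x g' : ℝ} (hg : HasDerivAt g g' x)
    (hle : ∀ᶠ y in 𝓝[>] x, g x ≤ g y) : 0 ≤ g' := by
  have ht : Tendsto (slope g x) (𝓝[>] x) (𝓝 g') :=
    hg.tendsto_slope.mono_left (nhdsWithin_mono x fun y hy => ne_of_gt hy)
  refine ge_of_tendsto ht ?_
  filter_upwards [hle, self_mem_nhdsWithin] with y h1 h2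
  rw [slope_def_field]
  exact div_nonneg (by linarith) (by linarith [mem_Ioi.1 h2])

/-! ### The maximum principle for the pair, signed zeroth-order coefficients -/

/-- **Weak maximum principle for Hamilton's Harnack pair on `[-1,1]`, case `c₁, c₂ ≤ 0`.**
Let `N₁, N₂` be continuous on `[-1,1] × [τ₀, T]`, with space derivatives `Dᵢ` (on the closed
interval), second space derivatives `Eᵢ` (interior) and time derivatives `Tᵢ` at every point of
`[-1,1] × (τ₀, T]`, coupled through `g` with `N₁ - N₂ = (1-s²) g` and `D₁ - D₂ = ∓2g` at `s = ±1`,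
and satisfying `Tᵢ ≥ (1-s²)Eᵢ - 4s Dᵢ + p(1-s²)Dᵢ + cᵢNᵢ + κᵢ g` (`κ₁ = -6`, `κ₂ = 2`) with
`cᵢ ≤ 0`.  If `N₁, N₂ ≥ 0` at `τ = τ₀`, then `N₁, N₂ ≥ 0` on `[-1,1] × [τ₀, T]`.
[cite: Hamilton1993Harnack, §5 (maximum principle for the Harnack quantity)] -/
theorem hamiltonPair_nonneg_of_nonpos
    {N₁ N₂ D₁ D₂ E₁ E₂ T₁ T₂ g p c₁ c₂ : ℝ → ℝ → ℝ} {τ₀ T : ℝ}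
    (hN₁ : ContinuousOn (fun q : ℝ × ℝ => N₁ q.1 q.2) (Icc (-1) 1 ×ˢ Icc τ₀ T))
    (hN₂ : ContinuousOn (fun q : ℝ × ℝ => N₂ q.1 q.2) (Icc (-1) 1 ×ˢ Icc τ₀ T))
    (hD₁ : ∀ s ∈ Icc (-1 : ℝ) 1, ∀ τ ∈ Ioc τ₀ T, HasDerivAt (fun x => N₁ x τ) (D₁ s τ) s)
    (hD₂ : ∀ s ∈ Icc (-1 : ℝ) 1, ∀ τ ∈ Ioc τ₀ T, HasDerivAt (fun x => N₂ x τ) (D₂ s τ) s)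
    (hE₁ : ∀ s ∈ Ioo (-1 : ℝ) 1, ∀ τ ∈ Ioc τ₀ T, HasDerivAt (fun x => D₁ x τ) (E₁ s τ) s)
    (hE₂ : ∀ s ∈ Ioo (-1 : ℝ) 1, ∀ τ ∈ Ioc τ₀ T, HasDerivAt (fun x => D₂ x τ) (E₂ s τ) s)
    (hT₁ : ∀ s ∈ Icc (-1 : ℝ) 1, ∀ τ ∈ Ioc τ₀ T, HasDerivAt (fun t => N₁ s t) (T₁ s τ) τ)
    (hT₂ : ∀ s ∈ Icc (-1 : ℝ) 1, ∀ τ ∈ Ioc τ₀ T, HasDerivAt (fun t => N₂ s t) (T₂ s τ) τ)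
    (hg : ∀ s ∈ Icc (-1 : ℝ) 1, ∀ τ ∈ Ioc τ₀ T, N₁ s τ - N₂ s τ = (1 - s ^ 2) * g s τ)
    (hg₁ : ∀ τ ∈ Ioc τ₀ T, D₁ 1 τ - D₂ 1 τ = -2 * g 1 τ)
    (hg₂ : ∀ τ ∈ Ioc τ₀ T, D₁ (-1) τ - D₂ (-1) τ = 2 * g (-1) τ)
    (hc₁ : ∀ s ∈ Icc (-1 : ℝ) 1, ∀ τ ∈ Ioc τ₀ T, c₁ s τ ≤ 0)
    (hc₂ : ∀ s ∈ Icc (-1 : ℝ) 1, ∀ τ ∈ Ioc τ₀ T, c₂ s τ ≤ 0)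
    (hpde₁ : ∀ s ∈ Icc (-1 : ℝ) 1, ∀ τ ∈ Ioc τ₀ T,
      (1 - s ^ 2) * E₁ s τ - 4 * s * D₁ s τ + p s τ * (1 - s ^ 2) * D₁ s τ + c₁ s τ * N₁ s τ
        - 6 * g s τ ≤ T₁ s τ)
    (hpde₂ : ∀ s ∈ Icc (-1 : ℝ) 1, ∀ τ ∈ Ioc τ₀ T,
      (1 - s ^ 2) * E₂ s τ - 4 * s * D₂ s τ + p s τ * (1 - s ^ 2) * D₂ s τ + c₂ s τ * N₂ s τ
        + 2 * g s τ ≤ T₂ s τ)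
    (h0 : ∀ s ∈ Icc (-1 : ℝ) 1, 0 ≤ N₁ s τ₀ ∧ 0 ≤ N₂ s τ₀) :
    ∀ s ∈ Icc (-1 : ℝ) 1, ∀ τ ∈ Icc τ₀ T, 0 ≤ N₁ s τ ∧ 0 ≤ N₂ s τ := by
  intro s₁ hs₁ τ₁ hτ₁
  have hT : τ₀ ≤ T := hτ₁.1.trans hτ₁.2
  -- it suffices to prove `Nᵢ ≥ -δ` for every `δ > 0`
  suffices key : ∀ δ : ℝ, 0 < δ → -δ ≤ N₁ s₁ τ₁ ∧ -δ ≤ N₂ s₁ τ₁ by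
    constructor
    · exact le_of_forall_pos_le_add fun δ hδ => by linarith [(key δ hδ).1]
    · exact le_of_forall_pos_le_add fun δ hδ => by linarith [(key δ hδ).2]
  intro δ hδ
  set ε : ℝ := δ / (1 + (T - τ₀)) with hε
  have hεpos : 0 < ε := by rw [hε]; exact div_pos hδ (by linarith)
  have h1T : (0 : ℝ) < 1 + (T - τ₀) := by linarith
  have hεT : ε * (1 + (T - τ₀)) = δ := by
    rw [hε]; field_simp
  -- the perturbed function on the compact rectangle
  set w : ℝ × ℝ → ℝ := fun q => min (N₁ q.1 q.2) (N₂ q.1 q.2) + ε * (1 + (q.2 - τ₀)) with hw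
  have hK : IsCompact (Icc (-1 : ℝ) 1 ×ˢ Icc τ₀ T) := isCompact_Icc.prod isCompact_Icc
  have hne : (Icc (-1 : ℝ) 1 ×ˢ Icc τ₀ T).Nonempty := ⟨(s₁, τ₁), hs₁, hτ₁⟩
  have hwc : ContinuousOn w (Icc (-1 : ℝ) 1 ×ˢ Icc τ₀ T) :=
    (continuous_min.comp_continuousOn (hN₁.prodMk hN₂)).add ((continuous_const.mul (continuous_const.add
      (continuous_snd.sub continuous_const))).continuousOn)
  obtain ⟨p₀, hp₀, hmin⟩ := hK.exists_isMinOn hne hwc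
  obtain ⟨s₀, t₀⟩ := p₀
  have hmin' : ∀ q ∈ Icc (-1 : ℝ) 1 ×ˢ Icc τ₀ T, w (s₀, t₀) ≤ w q := isMinOn_iff.1 hmin
  have hw₁ : w (s₀, t₀) ≤ w (s₁, τ₁) := hmin' _ ⟨hs₁, hτ₁⟩
  -- if the minimum of `w` is `≥ 0` we are done
  rcases le_or_gt 0 (w (s₀, t₀)) with hle | hlt
  · have h1 : 0 ≤ min (N₁ s₁ τ₁) (N₂ s₁ τ₁) + ε * (1 + (τ₁ - τ₀)) := hle.trans hw₁
    have h2 : ε * (1 + (τ₁ - τ₀)) ≤ ε * (1 + (T - τ₀)) :=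
      mul_le_mul_of_nonneg_left (by linarith [hτ₁.2]) hεpos.le
    constructor
    · linarith [min_le_left (N₁ s₁ τ₁) (N₂ s₁ τ₁)]
    · linarith [min_le_right (N₁ s₁ τ₁) (N₂ s₁ τ₁)]
  exfalso
  have hs₀ : s₀ ∈ Icc (-1 : ℝ) 1 := hp₀.1
  have ht₀ : t₀ ∈ Icc τ₀ T := hp₀.2
  have hm₀ : min (N₁ s₀ t₀) (N₂ s₀ t₀) < 0 := by
    have : min (N₁ s₀ t₀) (N₂ s₀ t₀) + ε * (1 + (t₀ - τ₀)) < 0 := hlt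
    nlinarith [ht₀.1]
  -- the minimum point is not at the initial time
  have ht₀0 : t₀ ≠ τ₀ := by
    intro h
    rw [h] at hm₀
    exact (lt_irrefl (0 : ℝ)) ((le_min (h0 s₀ hs₀).1 (h0 s₀ hs₀).2).trans_lt hm₀)
  have ht₀' : t₀ ∈ Ioc τ₀ T := ⟨lt_of_le_of_ne ht₀.1 (Ne.symm ht₀0), ht₀.2⟩
  -- ### the temporal condition `Tᵢ ≤ -ε` for a component realising the minimum
  have htime : ∀ {N Tn : ℝ → ℝ → ℝ}, HasDerivAt (fun t => N s₀ t) (Tn s₀ t₀) t₀ →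
      N s₀ t₀ = min (N₁ s₀ t₀) (N₂ s₀ t₀) →
      (∀ s t, min (N₁ s t) (N₂ s t) ≤ N s t) → Tn s₀ t₀ ≤ -ε := by
    intro N Tn hderiv hNmin hNge
    have hd : HasDerivAt (fun t => N s₀ t + ε * (1 + (t - τ₀))) (Tn s₀ t₀ + ε) t₀ := by
      have h2 : HasDerivAt (fun t : ℝ => ε * (1 + (t - τ₀))) ε t₀ := by
        simpa using (((hasDerivAt_id t₀).sub_const τ₀).const_add 1).const_mul ε
      exact hderiv.add h2
    have hle : ∀ᶠ t in 𝓝[<] t₀, N s₀ t₀ + ε * (1 + (t₀ - τ₀)) ≤ N s₀ t + ε * (1 + (t - τ₀)) := by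
      filter_upwards [Ioo_mem_nhdsLT ht₀'.1] with t ht
      have h := hmin' (s₀, t) ⟨hs₀, ht.1.le, ht.2.le.trans ht₀.2⟩
      simp only [hw] at h
      rw [hNmin]
      linarith [hNge s₀ t]
    have := hasDerivAt_nonpos_of_ge_left hd hle
    linarith
  -- ### spatial conditions for a component realising the minimum
  have hspace_ge : ∀ {N : ℝ → ℝ → ℝ}, N s₀ t₀ = min (N₁ s₀ t₀) (N₂ s₀ t₀) →
      (∀ s t, min (N₁ s t) (N₂ s t) ≤ N s t) → ∀ x ∈ Icc (-1 : ℝ) 1, N s₀ t₀ ≤ N x t₀ := by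
    intro N hNmin hNge x hx
    have h := hmin' (x, t₀) ⟨hx, ht₀⟩
    simp only [hw] at h
    rw [hNmin]
    linarith [hNge x t₀]
  have hinterior : ∀ {N D E : ℝ → ℝ → ℝ}, s₀ ∈ Ioo (-1 : ℝ) 1 →
      (∀ s ∈ Icc (-1 : ℝ) 1, HasDerivAt (fun x => N x t₀) (D s t₀) s) →
      HasDerivAt (fun x => D x t₀) (E s₀ t₀) s₀ →
      (∀ x ∈ Icc (-1 : ℝ) 1, N s₀ t₀ ≤ N x t₀) → D s₀ t₀ = 0 ∧ 0 ≤ E s₀ t₀ := by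
    intro N D E hs hD hE hge
    have hloc : IsLocalMin (fun x => N x t₀) s₀ := by
      filter_upwards [Ioo_mem_nhds hs.1 hs.2] with x hx
      exact hge x (Ioo_subset_Icc_self hx)
    have hd1 : ∀ᶠ x in 𝓝 s₀, HasDerivAt (fun x => N x t₀) (D x t₀) x := by
      filter_upwards [Ioo_mem_nhds hs.1 hs.2] with x hx
      exact hD x (Ioo_subset_Icc_self hx)
    -- second-order condition, from the local-maximum version applied to `-N`
    have h2 := deriv_deriv_nonpos_of_isLocalMax (f := fun x => -N x t₀) (f' := fun x => -D x t₀)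
      hloc.neg (hd1.mono fun x hx => hx.neg) hE.neg
    exact ⟨hloc.hasDerivAt_eq_zero (hD s₀ hs₀), by linarith⟩
  have hmin_le₁ : ∀ s t, min (N₁ s t) (N₂ s t) ≤ N₁ s t := fun s t => min_le_left _ _
  have hmin_le₂ : ∀ s t, min (N₁ s t) (N₂ s t) ≤ N₂ s t := fun s t => min_le_right _ _
  -- ### case analysis on the position of the minimum
  rcases eq_or_ne s₀ 1 with hs1 | hs1
  · -- right endpoint: both components vanish to the same order
    subst hs1
    have heq : N₁ 1 t₀ = N₂ 1 t₀ := by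
      have h := hg 1 hs₀ t₀ ht₀'; norm_num at h; linarith
    have hN₁min : N₁ 1 t₀ = min (N₁ 1 t₀) (N₂ 1 t₀) := by rw [heq, min_self]
    have hN₂min : N₂ 1 t₀ = min (N₁ 1 t₀) (N₂ 1 t₀) := by rw [heq, min_self]
    have hT := htime (hT₁ 1 hs₀ t₀ ht₀') hN₁min hmin_le₁
    have hDle : ∀ {N D : ℝ → ℝ → ℝ}, HasDerivAt (fun x => N x t₀) (D 1 t₀) 1 →
        (∀ x ∈ Icc (-1 : ℝ) 1, N 1 t₀ ≤ N x t₀) → D 1 t₀ ≤ 0 := by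
      intro N D hD hge
      refine hasDerivAt_nonpos_of_ge_left hD ?_
      filter_upwards [Ioo_mem_nhdsLT (show (-1 : ℝ) < 1 by norm_num)] with x hx
      exact hge x (Ioo_subset_Icc_self hx)
    have hD₁le := hDle (hD₁ 1 hs₀ t₀ ht₀') (hspace_ge hN₁min hmin_le₁)
    have hD₂le := hDle (hD₂ 1 hs₀ t₀ ht₀') (hspace_ge hN₂min hmin_le₂)
    have hN₁neg : N₁ 1 t₀ < 0 := by rw [hN₁min]; exact hm₀
    have hcN : 0 ≤ c₁ 1 t₀ * N₁ 1 t₀ := mul_nonneg_of_nonpos_of_nonpos (hc₁ 1 hs₀ t₀ ht₀') hN₁neg.le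
    have hP := hpde₁ 1 hs₀ t₀ ht₀'
    have hG := hg₁ t₀ ht₀'
    norm_num at hP
    linarith
  rcases eq_or_ne s₀ (-1) with hs2 | hs2
  · -- left endpoint
    subst hs2
    have heq : N₁ (-1) t₀ = N₂ (-1) t₀ := by
      have h := hg (-1) hs₀ t₀ ht₀'; norm_num at h; linarith
    have hN₁min : N₁ (-1) t₀ = min (N₁ (-1) t₀) (N₂ (-1) t₀) := by rw [heq, min_self]
    have hN₂min : N₂ (-1) t₀ = min (N₁ (-1) t₀) (N₂ (-1) t₀) := by rw [heq, min_self]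
    have hT := htime (hT₁ (-1) hs₀ t₀ ht₀') hN₁min hmin_le₁
    have hDge : ∀ {N D : ℝ → ℝ → ℝ}, HasDerivAt (fun x => N x t₀) (D (-1) t₀) (-1) →
        (∀ x ∈ Icc (-1 : ℝ) 1, N (-1) t₀ ≤ N x t₀) → 0 ≤ D (-1) t₀ := by
      intro N D hD hge
      refine hasDerivAt_nonneg_of_ge_right hD ?_
      filter_upwards [Ioo_mem_nhdsGT (show (-1 : ℝ) < 1 by norm_num)] with x hx
      exact hge x (Ioo_subset_Icc_self hx)
    have hD₁ge := hDge (hD₁ (-1) hs₀ t₀ ht₀') (hspace_ge hN₁min hmin_le₁)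
    have hD₂ge := hDge (hD₂ (-1) hs₀ t₀ ht₀') (hspace_ge hN₂min hmin_le₂)
    have hN₁neg : N₁ (-1) t₀ < 0 := by rw [hN₁min]; exact hm₀
    have hcN : 0 ≤ c₁ (-1) t₀ * N₁ (-1) t₀ :=
      mul_nonneg_of_nonpos_of_nonpos (hc₁ (-1) hs₀ t₀ ht₀') hN₁neg.le
    have hP := hpde₁ (-1) hs₀ t₀ ht₀'
    have hG := hg₂ t₀ ht₀'
    norm_num at hP
    linarith
  -- interior point
  have hs₀' : s₀ ∈ Ioo (-1 : ℝ) 1 := ⟨lt_of_le_of_ne hs₀.1 (Ne.symm hs2), lt_of_le_of_ne hs₀.2 hs1⟩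
  have h1s : 0 < 1 - s₀ ^ 2 := by nlinarith [hs₀'.1, hs₀'.2]
  rcases le_or_gt (N₁ s₀ t₀) (N₂ s₀ t₀) with h12 | h12
  · -- the first component realises the minimum
    have hN₁min : N₁ s₀ t₀ = min (N₁ s₀ t₀) (N₂ s₀ t₀) := (min_eq_left h12).symm
    have hT := htime (hT₁ s₀ hs₀ t₀ ht₀') hN₁min hmin_le₁
    obtain ⟨hD0, hE0⟩ := hinterior hs₀' (fun s hs => hD₁ s hs t₀ ht₀') (hE₁ s₀ hs₀' t₀ ht₀')
      (hspace_ge hN₁min hmin_le₁)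
    have hN₁neg : N₁ s₀ t₀ < 0 := by rw [hN₁min]; exact hm₀
    have hcN : 0 ≤ c₁ s₀ t₀ * N₁ s₀ t₀ :=
      mul_nonneg_of_nonpos_of_nonpos (hc₁ s₀ hs₀ t₀ ht₀') hN₁neg.le
    have hgle : g s₀ t₀ ≤ 0 := by
      have h := hg s₀ hs₀ t₀ ht₀'
      by_contra hpos
      push Not at hpos
      nlinarith [mul_pos h1s hpos]
    have hP := hpde₁ s₀ hs₀ t₀ ht₀'
    rw [hD0] at hP
    have hEE : 0 ≤ (1 - s₀ ^ 2) * E₁ s₀ t₀ := mul_nonneg h1s.le hE0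
    nlinarith
  · -- the second component realises the minimum
    have hN₂min : N₂ s₀ t₀ = min (N₁ s₀ t₀) (N₂ s₀ t₀) := (min_eq_right h12.le).symm
    have hT := htime (hT₂ s₀ hs₀ t₀ ht₀') hN₂min hmin_le₂
    obtain ⟨hD0, hE0⟩ := hinterior hs₀' (fun s hs => hD₂ s hs t₀ ht₀') (hE₂ s₀ hs₀' t₀ ht₀')
      (hspace_ge hN₂min hmin_le₂)
    have hN₂neg : N₂ s₀ t₀ < 0 := by rw [hN₂min]; exact hm₀
    have hcN : 0 ≤ c₂ s₀ t₀ * N₂ s₀ t₀ :=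
      mul_nonneg_of_nonpos_of_nonpos (hc₂ s₀ hs₀ t₀ ht₀') hN₂neg.le
    have hgge : 0 ≤ g s₀ t₀ := by
      have h := hg s₀ hs₀ t₀ ht₀'
      by_contra hneg
      push Not at hneg
      nlinarith [mul_pos h1s (neg_pos.2 hneg)]
    have hP := hpde₂ s₀ hs₀ t₀ ht₀'
    rw [hD0] at hP
    have hEE : 0 ≤ (1 - s₀ ^ 2) * E₂ s₀ t₀ := mul_nonneg h1s.le hE0
    nlinarith

/-! ### Bounded zeroth-order coefficients -/

/-- **Weak maximum principle for Hamilton's Harnack pair on `[-1,1]`** with bounded zeroth-order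
coefficients `|cᵢ| ≤ M` (reduce to `cᵢ - M ≤ 0` by the weight `e^{-Mτ}`).
[cite: Hamilton1993Harnack, §5 (maximum principle for the Harnack quantity)] -/
theorem hamiltonPair_nonneg
    {N₁ N₂ D₁ D₂ E₁ E₂ T₁ T₂ g p c₁ c₂ : ℝ → ℝ → ℝ} {τ₀ T M : ℝ}
    (hN₁ : ContinuousOn (fun q : ℝ × ℝ => N₁ q.1 q.2) (Icc (-1) 1 ×ˢ Icc τ₀ T))
    (hN₂ : ContinuousOn (fun q : ℝ × ℝ => N₂ q.1 q.2) (Icc (-1) 1 ×ˢ Icc τ₀ T))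
    (hD₁ : ∀ s ∈ Icc (-1 : ℝ) 1, ∀ τ ∈ Ioc τ₀ T, HasDerivAt (fun x => N₁ x τ) (D₁ s τ) s)
    (hD₂ : ∀ s ∈ Icc (-1 : ℝ) 1, ∀ τ ∈ Ioc τ₀ T, HasDerivAt (fun x => N₂ x τ) (D₂ s τ) s)
    (hE₁ : ∀ s ∈ Ioo (-1 : ℝ) 1, ∀ τ ∈ Ioc τ₀ T, HasDerivAt (fun x => D₁ x τ) (E₁ s τ) s)
    (hE₂ : ∀ s ∈ Ioo (-1 : ℝ) 1, ∀ τ ∈ Ioc τ₀ T, HasDerivAt (fun x => D₂ x τ) (E₂ s τ) s)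
    (hT₁ : ∀ s ∈ Icc (-1 : ℝ) 1, ∀ τ ∈ Ioc τ₀ T, HasDerivAt (fun t => N₁ s t) (T₁ s τ) τ)
    (hT₂ : ∀ s ∈ Icc (-1 : ℝ) 1, ∀ τ ∈ Ioc τ₀ T, HasDerivAt (fun t => N₂ s t) (T₂ s τ) τ)
    (hg : ∀ s ∈ Icc (-1 : ℝ) 1, ∀ τ ∈ Ioc τ₀ T, N₁ s τ - N₂ s τ = (1 - s ^ 2) * g s τ)
    (hg₁ : ∀ τ ∈ Ioc τ₀ T, D₁ 1 τ - D₂ 1 τ = -2 * g 1 τ)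
    (hg₂ : ∀ τ ∈ Ioc τ₀ T, D₁ (-1) τ - D₂ (-1) τ = 2 * g (-1) τ)
    (hc₁ : ∀ s ∈ Icc (-1 : ℝ) 1, ∀ τ ∈ Ioc τ₀ T, |c₁ s τ| ≤ M)
    (hc₂ : ∀ s ∈ Icc (-1 : ℝ) 1, ∀ τ ∈ Ioc τ₀ T, |c₂ s τ| ≤ M)
    (hpde₁ : ∀ s ∈ Icc (-1 : ℝ) 1, ∀ τ ∈ Ioc τ₀ T,
      (1 - s ^ 2) * E₁ s τ - 4 * s * D₁ s τ + p s τ * (1 - s ^ 2) * D₁ s τ + c₁ s τ * N₁ s τ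
        - 6 * g s τ ≤ T₁ s τ)
    (hpde₂ : ∀ s ∈ Icc (-1 : ℝ) 1, ∀ τ ∈ Ioc τ₀ T,
      (1 - s ^ 2) * E₂ s τ - 4 * s * D₂ s τ + p s τ * (1 - s ^ 2) * D₂ s τ + c₂ s τ * N₂ s τ
        + 2 * g s τ ≤ T₂ s τ)
    (h0 : ∀ s ∈ Icc (-1 : ℝ) 1, 0 ≤ N₁ s τ₀ ∧ 0 ≤ N₂ s τ₀) :
    ∀ s ∈ Icc (-1 : ℝ) 1, ∀ τ ∈ Icc τ₀ T, 0 ≤ N₁ s τ ∧ 0 ≤ N₂ s τ := by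
  -- the weight `r τ = e^{-Mτ} > 0`, `r' = -M r`
  set r : ℝ → ℝ := fun τ => Real.exp (-M * τ) with hr
  have hrpos : ∀ τ, 0 < r τ := fun τ => Real.exp_pos _
  have hrd : ∀ τ, HasDerivAt r (-M * r τ) τ := by
    intro τ
    have h := ((hasDerivAt_id τ).const_mul (-M)).exp
    simp only [mul_one, id] at h
    simpa [hr, mul_comm] using h
  have key := hamiltonPair_nonneg_of_nonpos
    (N₁ := fun s τ => r τ * N₁ s τ) (N₂ := fun s τ => r τ * N₂ s τ)
    (D₁ := fun s τ => r τ * D₁ s τ) (D₂ := fun s τ => r τ * D₂ s τ)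
    (E₁ := fun s τ => r τ * E₁ s τ) (E₂ := fun s τ => r τ * E₂ s τ)
    (T₁ := fun s τ => r τ * T₁ s τ - M * (r τ * N₁ s τ))
    (T₂ := fun s τ => r τ * T₂ s τ - M * (r τ * N₂ s τ))
    (g := fun s τ => r τ * g s τ) (p := p) (c₁ := fun s τ => c₁ s τ - M)
    (c₂ := fun s τ => c₂ s τ - M) (τ₀ := τ₀) (T := T)
    ((Real.continuous_exp.comp (continuous_const.mul continuous_snd)).continuousOn.mul hN₁)
    ((Real.continuous_exp.comp (continuous_const.mul continuous_snd)).continuousOn.mul hN₂)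
    (fun s hs τ hτ => (hD₁ s hs τ hτ).const_mul _) (fun s hs τ hτ => (hD₂ s hs τ hτ).const_mul _)
    (fun s hs τ hτ => (hE₁ s hs τ hτ).const_mul _) (fun s hs τ hτ => (hE₂ s hs τ hτ).const_mul _)
    (fun s hs τ hτ => ((hrd τ).mul (hT₁ s hs τ hτ)).congr_deriv (by ring))
    (fun s hs τ hτ => ((hrd τ).mul (hT₂ s hs τ hτ)).congr_deriv (by ring))
    (fun s hs τ hτ => by linear_combination (r τ) * hg s hs τ hτ)
    (fun τ hτ => by linear_combination (r τ) * hg₁ τ hτ)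
    (fun τ hτ => by linear_combination (r τ) * hg₂ τ hτ)
    (fun s hs τ hτ => by linarith [(abs_le.1 (hc₁ s hs τ hτ)).2])
    (fun s hs τ hτ => by linarith [(abs_le.1 (hc₂ s hs τ hτ)).2])
    (fun s hs τ hτ => by
      have h := mul_le_mul_of_nonneg_left (hpde₁ s hs τ hτ) (hrpos τ).le
      nlinarith [h])
    (fun s hs τ hτ => by
      have h := mul_le_mul_of_nonneg_left (hpde₂ s hs τ hτ) (hrpos τ).le
      nlinarith [h])
    (fun s hs => ⟨mul_nonneg (hrpos τ₀).le (h0 s hs).1, mul_nonneg (hrpos τ₀).le (h0 s hs).2⟩)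
  intro s hs τ hτ
  have h := key s hs τ hτ
  exact ⟨le_of_mul_le_mul_left (by simpa using h.1) (hrpos τ),
    le_of_mul_le_mul_left (by simpa using h.2) (hrpos τ)⟩

end Literature.Analysis.PDE
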